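import Literature.NumberTheory.GaloisRepresentations.PontryaginTateDualInverseLimit
import HarnessLib

/-!
# The compact Tate dual `T* = lim_k Hom(D_k, μ_{p^k})`, II: scalars, the `Λ`-module structure, and
# `H¹_cont(Γ, T*) ≃ lim_k H¹(Γ, Hom(D_k, μ_{p^k}))`

Topic `NumberTheory/GaloisRepresentations`; sequel of `PontryaginTateDualInverseLimit.lean` (same
namespace `Literature.NumberTheory.GaloisRepresentations.DiscreteGaloisModule.TorsionLayers`).
Definitions WITH BODIES and theorems; no named fact, no `sorry`, no instance, no notation. Seat
`bsd-line-x1-p1-w4` gen 18 (prover, width seat of cell `bsd-eis`), brick C1 of the road memo «SUR-Λ»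
(crux `GoodLatticeBDPValue`, stmt-BirchSwinnertonDyer-19032).

MATHEMATICS (R. Greenberg, Kyoto J. Math. 50 (2010), §2 p. 6 L5–8: "we can define a `Λ`-module
`T* = Hom(D, μ_{p^∞})`"; (7) p. 7: the cohomology sequence of `0 → T* →θ T* → T*/θT* → 0`):

* `E.dualEnd θ hθ : T* →+ T*`, `(θ̂ x)(d) = x(θ d)` for an additive `θ : D → D` preserving the layers
  (`evalDual_dualEnd`); continuous (`continuous_dualEnd`); `Γ_K`-equivariant when `θ` is
  (`dualEnd_limitRep`), whence the `TopRep` endomorphism **`E.dualEndHom θ hθ hθτ : T* ⟶ T*`** (the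
  currency of `cohomologyMap`, so `Hⁿ(θ̂)` is the scalar on `Hⁿ_cont(Γ_K, T*)`); INJECTIVE when `θ`
  is surjective on `D` (`dualEnd_injective_of_surjective`: "`D` divisible ⟹ `T*` torsion-free",
  Prop. 2.1.1 proof, p. 7 L28); `dualEnd_comp/_add/_id/_zero/_congr`;
* **`E.limitModule Λ hΛ : Module Λ T*`** (a reducible `def`, install with `letI`) for a commutative
  `Λ` acting on `D` and preserving the layers, `(r·x)(d) = x(r·d)` (`evalDual_smul` — the `map_smul`
  clause of the Greenberg dictionary's `IsDualPairing`), commuting with `Γ_K` (`limitRep_smul`),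
  continuous (`continuous_limitModule_smul`);
* **`E.continuousCohomologyOneEquiv : H¹_cont(Γ_K, T*) ≃+ lim_k H¹(Γ_K, Hom(D_k, μ_{p^k}))`** (the
  tree's `DiscreteInvSystem.continuousCohomologyOneLimitEquiv` with its hypotheses discharged by part
  I) and its twin `E.continuousCohomologyOneEquivComap φ` along any `φ : H →ₜ* Γ_K` (e.g.
  `Γ_{K_v} → Γ_K`), via the generic restriction `DiscreteInvSystem.comap` of an inverse system
  (`comap_limitRep : (S.comap φ).limitRep = S.limitRep.restrict φ`).

HONESTY. Infrastructure only; nothing here proves a statement of Greenberg's papers or any summit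
statement; BSD is not advanced. AI-typed, kernel-checked.

## References
* R. Greenberg, *Surjectivity of the global-to-local map defining a Selmer group*, Kyoto J. Math. 50
  (2010) 853–888, §2 p. 6 L5–8, (7)–(8) pp. 7–8. [Greenberg2010]
* J. Neukirch, A. Schmidt, K. Wingberg, *Cohomology of Number Fields*, 2nd ed. (2008), II §7
  Thm. (2.7.5). [NeukirchSchmidtWingberg2008]
-/

noncomputable section

open Function CategoryTheory
open _root_.TopRep _root_.ContRepresentation _root_.ContinuousCohomology
open Literature.NumberTheory.GaloisRepresentations.DiscreteGaloisModule

namespace Literature.NumberTheory.GaloisRepresentations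

variable {K : Type} [Field K] {D : Type} [AddCommGroup D] [TopologicalSpace D] [DiscreteTopology D]

/-! ### Restricting an inverse system of discrete modules along a continuous homomorphism -/

namespace DiscreteInvSystem

variable {G : Type} [Group G] [TopologicalSpace G] {ι : Type} {M : ι → Type}
  [∀ n, AddCommGroup (M n)] [∀ n, TopologicalSpace (M n)] (S : DiscreteInvSystem G M)
  {H : Type} [Group H] [TopologicalSpace H] (φ : H →ₜ* G)

/-- **Restriction of an inverse system along `φ : H → G`** (e.g. `Γ_{K_v} → Γ_K`): same modules and
transition maps, actions restricted. [cite: NeukirchSchmidtWingberg2008, II §7 Thm 2.7.5] -/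
def comap : DiscreteInvSystem H M where
  le := S.le
  le_refl := S.le_refl
  le_trans := S.le_trans
  ρ := fun n => (S.ρ n).restrict φ
  red := fun h => S.red h
  red_smul := fun h g x => S.red_smul h (φ g) x
  red_refl := S.red_refl
  red_trans := S.red_trans

/-- The limit of the restricted system is the same subgroup. [cite: NeukirchSchmidtWingberg2008, II §7 Thm 2.7.5] -/
theorem comap_limit : (S.comap φ).limit = S.limit := rfl

/-- The limit representation of the restricted system is the restriction of the limit
representation. [cite: NeukirchSchmidtWingberg2008, II §7 Thm 2.7.5] -/
theorem comap_limitRep : (S.comap φ).limitRep = S.limitRep.restrict φ :=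
  ContinuousRep.ext fun _ => rfl

/-- A cofinal chain of `S` is a cofinal chain of the restricted system. [cite: NeukirchSchmidtWingberg2008, II §7 Thm 2.7.5] -/
def comapChain (c : S.CofinalChain) : (S.comap φ).CofinalChain :=
  ⟨c.seq, c.le_succ, c.cofinal⟩

end DiscreteInvSystem

namespace DiscreteGaloisModule.TorsionLayers

variable {τ : DiscreteGaloisModule K D} {p : ℕ} (E : τ.TorsionLayers p)

/-! ### Interface with the finite-level pairings (level change `μ_{p^n} ⊆ μ_{p^m}`) -/

section Interface

/-- **`μ_{p^n} ⊆ μ_{p^m}` applied to `(res f)(x)` gives back `f(x)`** (`n ≤ m`, `x ∈ D_n`): the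
hypothesis `hred` of the tree's level-change lemmas for the local Tate pairing
(`LocalTatePairingLevelChange.lean`), for the transition maps of `dualSystem`.
[cite: Greenberg2010, §2 p. 6 L1–12] [cite: MilneADT2006, I §2] -/
theorem muInclusion_dualRes_apply {n m : ℕ} (h : n ≤ m) (f : E.LayerDual m) (x : E.N n) :
    muInclusion K (pow_dvd_pow p h) (E.dualRes h f x) = f (E.incl h x) :=
  muVal_injective K (p ^ m) rfl

/-- The transition morphism of `dualSystem` in `TopRep` is `dualRes` on elements.
[cite: Greenberg2010, §2 p. 6 L1–12] -/
@[simp] theorem dualSystem_redHom_hom_apply {n m : ℕ} (h : n ≤ m) (f : E.LayerDual m) :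
    (E.dualSystem.redHom h).hom f = E.dualRes h f := rfl

/-- **The inclusion of layers `D_n → D_m` as a morphism of discrete `Γ_K`-modules** (`n ≤ m`).
[cite: Greenberg2010, §2 p. 6 L1–12] -/
def layerInclHom {n m : ℕ} (h : n ≤ m) : (E.layerRep n).toTopRep ⟶ (E.layerRep m).toTopRep :=
  TopRep.ofHom ⟨⟨E.incl h, continuous_of_discreteTopology⟩, fun σ => by
    ext x
    rfl⟩

/-- `layerInclHom` on elements. [cite: Greenberg2010, §2 p. 6 L1–12] -/
@[simp] theorem layerInclHom_hom_apply {n m : ℕ} (h : n ≤ m) (x : E.N n) :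
    (E.layerInclHom h).hom x = E.incl h x := rfl

/-- The projection `T* → Hom(D_k, μ_{p^k})` of `dualSystem` in `TopRep` is the `k`-th coordinate.
[cite: Greenberg2010, §2 p. 6 L1–12] -/
@[simp] theorem dualSystem_projHom_hom_apply (k : ℕ) (x : E.dualSystem.limit) :
    (E.dualSystem.projHom k).hom x = (x : ∀ k, E.LayerDual k) k := rfl

end Interface

/-! ### Vanishing of fixed vectors: `Hom_H(D, K̄ˣ) = 0 ⟹ (T*)^H = 0` -/

section Fixed

variable {H : Type} [Group H] [TopologicalSpace H] (φ : H →ₜ* Field.absoluteGaloisGroup K)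

/-- **`(T*)^H = 0` from the vanishing of `H`-equivariant maps `D → K̄ˣ`** (the dictionary's
`LOC1`: "`H⁰(K_η, T*) = 0`", hypothesis (i) of Greenberg 2010 Props. 2.1.1 / 2.3.2): if every additive
`f : D → K̄ˣ` with `f(σ d) = σ·f(d)` for all `σ` in the image of `φ : H → Γ_K` vanishes, then an
element of `T*` fixed by `φ(H)` is `0`. [cite: Greenberg2010, Prop. 2.1.1 (p. 7 L24–27), §2.1 p. 6 L1–6] -/
theorem eq_zero_of_forall_limitRep_eq_self
    (hloc : ∀ f : D →+ UnitsCarrier K,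
      (∀ (σ : H) (d : D), f (τ (φ σ) d) = units K (φ σ) (f d)) → f = 0)
    (x : E.dualSystem.limit) (hx : ∀ σ : H, E.dualSystem.limitRep (φ σ) x = x) : x = 0 := by
  apply E.evalDual_injective
  rw [map_zero]
  exact hloc _ fun σ d => (E.limitRep_apply_eq_self_iff (φ σ) x).1 (hx σ) d

/-- The same for the restricted system `E.dualSystem.comap φ` (whose limit representation is
`T*|_H`, `DiscreteInvSystem.comap_limitRep`): `(T*|_H)^H = 0` — the hypothesis `hH0` of the tree's
`ContinuousH1TorsionOfRegularScalar` / `…OfInjectiveEndomorphism` (Greenberg 2010 (8)).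
[cite: Greenberg2010, Prop. 2.1.1 (p. 7 L24 – p. 8 L6)] -/
theorem eq_zero_of_forall_comap_limitRep_eq_self
    (hloc : ∀ f : D →+ UnitsCarrier K,
      (∀ (σ : H) (d : D), f (τ (φ σ) d) = units K (φ σ) (f d)) → f = 0)
    (x : (E.dualSystem.comap φ).limit) (hx : ∀ σ : H, (E.dualSystem.comap φ).limitRep σ x = x) :
    x = 0 :=
  E.eq_zero_of_forall_limitRep_eq_self φ hloc x hx

end Fixed

/-! ### Endomorphisms of `D` acting on `T*` (the scalars of `Λ`) -/

section End

variable (θ : D →+ D) (hθ : ∀ (k : ℕ), ∀ d ∈ E.N k, θ d ∈ E.N k)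

/-- The restriction of `θ` to the layer `D_k`. [cite: Greenberg2010, §2 p. 6 L5–8] -/
def layerEnd (k : ℕ) : E.N k →+ E.N k :=
  (θ.toIntLinearMap.restrict fun x hx => hθ k x hx).toAddMonoidHom

/-- Unfolding `layerEnd`. [cite: Greenberg2010, §2 p. 6 L5–8] -/
@[simp] theorem coe_layerEnd_apply (k : ℕ) (x : E.N k) : ((E.layerEnd θ hθ k x : E.N k) : D) = θ x := rfl

/-- `f ↦ f ∘ θ` on `Hom(D_k, μ_{p^k})`. [cite: Greenberg2010, §2 p. 6 L5–8] -/
def layerDualEnd (k : ℕ) : E.LayerDual k →+ E.LayerDual k where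
  toFun f := E.mkLayerDual (fun x => E.uval f (E.layerEnd θ hθ k x)) (fun x => E.uval_pow_eq_one f _)
    fun x y => by rw [map_add, uval_map_add]
  map_zero' := E.ext_uval fun x => by rw [uval_mkLayerDual, uval_zero, uval_zero]
  map_add' f g := E.ext_uval fun x => by
    rw [uval_mkLayerDual, uval_add, uval_add, uval_mkLayerDual, uval_mkLayerDual]

/-- Unit values of `layerDualEnd`: `(f ∘ θ)(x) = f(θ x)`. [cite: Greenberg2010, §2 p. 6 L5–8] -/
@[simp] theorem uval_layerDualEnd (k : ℕ) (f : E.LayerDual k) (x : E.N k) :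
    E.uval (E.layerDualEnd θ hθ k f) x = E.uval f (E.layerEnd θ hθ k x) := rfl

/-- **The endomorphism `θ̂` of `T*` induced by `θ : D → D`** (`(θ̂ x)(d) = x(θ d)`): for `θ` = the action
of a scalar of `Λ` this is the `Λ`-module structure of `T* = Hom(D, μ_{p^∞})`, `(θ·x)(d) = x(θ d)`.
[cite: Greenberg2010, §2 p. 6 L5–8] -/
def dualEnd : E.dualSystem.limit →+ E.dualSystem.limit where
  toFun x := ⟨fun k => E.layerDualEnd θ hθ k ((x : ∀ k, E.LayerDual k) k), fun n m h =>
    E.ext_uval fun y => by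
      rw [dualSystem_red, uval_dualRes, uval_layerDualEnd, uval_layerDualEnd, ← E.dualRes_coord x h,
        uval_dualRes]
      rfl⟩
  map_zero' := Subtype.ext (funext fun k => map_zero _)
  map_add' x y := Subtype.ext (funext fun k => map_add _ _ _)

/-- Coordinates of `θ̂ x`. [cite: Greenberg2010, §2 p. 6 L5–8] -/
@[simp] theorem coe_dualEnd_apply (x : E.dualSystem.limit) (k : ℕ) :
    (E.dualEnd θ hθ x : ∀ k, E.LayerDual k) k = E.layerDualEnd θ hθ k ((x : ∀ k, E.LayerDual k) k) := rfl

/-- **`(θ̂ x)(d) = x(θ d)`.** [cite: Greenberg2010, §2 p. 6 L5–8] -/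
theorem evalDual_dualEnd (x : E.dualSystem.limit) (d : D) :
    E.evalDual (E.dualEnd θ hθ x) d = E.evalDual x (θ d) := by
  obtain ⟨k, hk⟩ := E.exhaustive d
  apply unitsVal_injective K
  rw [E.unitsVal_evalDual_apply _ hk, E.unitsVal_evalDual_apply _ (hθ k d hk), coe_dualEnd_apply,
    uval_layerDualEnd]
  rfl

/-- `θ̂` is continuous (coordinatewise, into discrete levels). [cite: Greenberg2010, §2 p. 6 L5–8] -/
theorem continuous_dualEnd : Continuous (E.dualEnd θ hθ) := by
  refine continuous_induced_rng.2 (continuous_pi fun k => ?_)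
  exact (continuous_of_discreteTopology : Continuous (E.layerDualEnd θ hθ k)).comp
    (E.dualSystem.continuous_projAddHom k)

/-- **`θ̂` is `Γ_K`-equivariant when `θ` is.** [cite: Greenberg2010, §2 p. 6 L5–8] -/
theorem dualEnd_limitRep (hθτ : ∀ (σ : Field.absoluteGaloisGroup K) (d : D), θ (τ σ d) = τ σ (θ d))
    (σ : Field.absoluteGaloisGroup K) (x : E.dualSystem.limit) :
    E.dualEnd θ hθ (E.dualSystem.limitRep σ x) = E.dualSystem.limitRep σ (E.dualEnd θ hθ x) := by
  apply E.evalDual_injective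
  ext d
  rw [evalDual_dualEnd, evalDual_limitRep, evalDual_limitRep, evalDual_dualEnd, hθτ]

/-- **`θ̂` as an endomorphism of the topological `Γ_K`-representation `T*`** (Mathlib `TopRep`), for
`θ` commuting with `Γ_K` — the currency of `cohomologyMap`, so that
`Hⁿ(θ̂) : Hⁿ(Γ_K, T*) → Hⁿ(Γ_K, T*)` is the action of the scalar. [cite: Greenberg2010, §2 p. 6 L5–8, (7) p. 7] -/
def dualEndHom (hθτ : ∀ (σ : Field.absoluteGaloisGroup K) (d : D), θ (τ σ d) = τ σ (θ d)) :
    E.dualSystem.limitRep.toTopRep ⟶ E.dualSystem.limitRep.toTopRep :=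
  TopRep.ofHom ⟨⟨(E.dualEnd θ hθ).toIntLinearMap, E.continuous_dualEnd θ hθ⟩, fun σ =>
    ContinuousLinearMap.ext fun x => by exact E.dualEnd_limitRep θ hθ hθτ σ x⟩

/-- Unfolding `dualEndHom`. [cite: Greenberg2010, §2 p. 6 L5–8] -/
@[simp] theorem dualEndHom_hom_apply
    (hθτ : ∀ (σ : Field.absoluteGaloisGroup K) (d : D), θ (τ σ d) = τ σ (θ d))
    (x : E.dualSystem.limit) : (E.dualEndHom θ hθ hθτ).hom x = E.dualEnd θ hθ x := rfl

/-- **`θ̂` is injective when `θ` is surjective on `D`** ("`D` divisible ⟹ `T*` torsion-free",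
Greenberg 2010 p. 7 L28: "The first assumption means that `T*` is a torsion-free `Λ`-module").
[cite: Greenberg2010, Prop. 2.1.1 proof (p. 7 L28–32)] -/
theorem dualEnd_injective_of_surjective (hs : Surjective θ) : Injective (E.dualEnd θ hθ) := by
  intro x y hxy
  apply E.evalDual_injective
  ext d
  obtain ⟨d', rfl⟩ := hs d
  rw [← E.evalDual_dualEnd θ hθ, ← E.evalDual_dualEnd θ hθ, hxy]

/-- `θ̂` of the identity-like composite: `θ̂₁ ∘ θ̂₂ = (θ₂ ∘ θ₁)^` — composition rule
`(θ₁ θ₂)^ = θ̂₂ ∘ θ̂₁` read through `evalDual`. [cite: Greenberg2010, §2 p. 6 L5–8] -/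
theorem dualEnd_comp (θ' : D →+ D) (hθ' : ∀ (k : ℕ), ∀ d ∈ E.N k, θ' d ∈ E.N k)
    (x : E.dualSystem.limit) :
    E.dualEnd θ hθ (E.dualEnd θ' hθ' x) =
      E.dualEnd (θ'.comp θ) (fun k d hd => hθ' k _ (hθ k d hd)) x := by
  apply E.evalDual_injective
  ext d
  rw [evalDual_dualEnd, evalDual_dualEnd, evalDual_dualEnd]
  rfl

/-- `θ̂` is additive in `θ`. [cite: Greenberg2010, §2 p. 6 L5–8] -/
theorem dualEnd_add (θ' : D →+ D) (hθ' : ∀ (k : ℕ), ∀ d ∈ E.N k, θ' d ∈ E.N k)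
    (x : E.dualSystem.limit) :
    E.dualEnd (θ + θ') (fun k d hd => (E.N k).add_mem (hθ k d hd) (hθ' k d hd)) x =
      E.dualEnd θ hθ x + E.dualEnd θ' hθ' x := by
  apply E.evalDual_injective
  ext d
  simp only [evalDual_dualEnd, map_add, AddMonoidHom.add_apply]

/-- `θ̂ = id` for `θ = id`. [cite: Greenberg2010, §2 p. 6 L5–8] -/
theorem dualEnd_id (x : E.dualSystem.limit) :
    E.dualEnd (AddMonoidHom.id D) (fun _ _ hd => hd) x = x := by
  apply E.evalDual_injective
  ext d
  rw [evalDual_dualEnd]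
  rfl

/-- `θ̂` depends only on the values of `θ`. [cite: Greenberg2010, §2 p. 6 L5–8] -/
theorem dualEnd_congr {θ θ' : D →+ D} (h : ∀ d, θ d = θ' d) (hθ : ∀ (k : ℕ), ∀ d ∈ E.N k, θ d ∈ E.N k)
    (hθ' : ∀ (k : ℕ), ∀ d ∈ E.N k, θ' d ∈ E.N k) (x : E.dualSystem.limit) :
    E.dualEnd θ hθ x = E.dualEnd θ' hθ' x := by
  apply E.evalDual_injective
  ext d
  rw [evalDual_dualEnd, evalDual_dualEnd, h]

/-- `θ̂ = 0` for `θ = 0`. [cite: Greenberg2010, §2 p. 6 L5–8] -/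
theorem dualEnd_zero (x : E.dualSystem.limit) :
    E.dualEnd (0 : D →+ D) (fun k _ _ => (E.N k).zero_mem) x = 0 := by
  apply E.evalDual_injective
  ext d
  rw [evalDual_dualEnd, AddMonoidHom.zero_apply, map_zero, map_zero, AddMonoidHom.zero_apply]

end End

/-! ### The `Λ`-module structure of `T*` (scalars acting on `D` and preserving the layers) -/

section Scalars

variable (Λ : Type) [CommRing Λ] [Module Λ D]
  (hΛ : ∀ (k : ℕ) (r : Λ), ∀ d ∈ E.N k, r • d ∈ E.N k)

/-- The action of a scalar `r ∈ Λ` on `T*`: `(r·x)(d) = x(r·d)` (`θ̂` for `θ = r·`).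
[cite: Greenberg2010, §2 p. 6 L5–8] -/
def smulEnd (r : Λ) : E.dualSystem.limit →+ E.dualSystem.limit :=
  E.dualEnd (DistribSMul.toAddMonoidHom D r) (hΛ · r)

/-- **`(r·x)(d) = x(r·d)`.** [cite: Greenberg2010, §2 p. 6 L5–8] -/
theorem evalDual_smulEnd (r : Λ) (x : E.dualSystem.limit) (d : D) :
    E.evalDual (E.smulEnd Λ hΛ r x) d = E.evalDual x (r • d) :=
  E.evalDual_dualEnd _ _ x d

/-- **The `Λ`-module structure of `T* = Hom(D, μ_{p^∞})`, `(r·x)(d) = x(r·d)`** (Greenberg 2010 p. 6: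
"we can define a `Λ`-module `T* = Hom(D, μ_{p^∞})`"), as a `def` (to be installed with `letI`), for
scalars `Λ` acting on `D` and preserving the layers. [cite: Greenberg2010, §2 p. 6 L5–8] -/
@[reducible] def limitModule : Module Λ E.dualSystem.limit where
  smul r x := E.smulEnd Λ hΛ r x
  one_smul x := by
    change E.smulEnd Λ hΛ 1 x = x
    apply E.evalDual_injective
    ext d
    rw [evalDual_smulEnd, one_smul]
  mul_smul r s x := by
    change E.smulEnd Λ hΛ (r * s) x = E.smulEnd Λ hΛ r (E.smulEnd Λ hΛ s x)
    apply E.evalDual_injective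
    ext d
    rw [evalDual_smulEnd, evalDual_smulEnd, evalDual_smulEnd, mul_comm, mul_smul]
  smul_zero r := map_zero (E.smulEnd Λ hΛ r)
  smul_add r x y := map_add (E.smulEnd Λ hΛ r) x y
  add_smul r s x := by
    change E.smulEnd Λ hΛ (r + s) x = E.smulEnd Λ hΛ r x + E.smulEnd Λ hΛ s x
    apply E.evalDual_injective
    ext d
    rw [map_add, evalDual_smulEnd, AddMonoidHom.add_apply, evalDual_smulEnd, evalDual_smulEnd, add_smul,
      map_add]
  zero_smul x := by
    change E.smulEnd Λ hΛ 0 x = 0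
    apply E.evalDual_injective
    ext d
    rw [evalDual_smulEnd, zero_smul, map_zero, map_zero]
    rfl

/-- Unfolding the scalar action of `limitModule`. [cite: Greenberg2010, §2 p. 6 L5–8] -/
theorem limitModule_smul_def (r : Λ) (x : E.dualSystem.limit) :
    letI := E.limitModule Λ hΛ
    r • x = E.smulEnd Λ hΛ r x := rfl

/-- **The pairing `T* × D → K̄ˣ` is `Λ`-balanced**: `(r·x)(d) = x(r·d)` for the module structure
`limitModule` (the `map_smul` clause of the dictionary's `Greenberg2016.IsDualPairing`).
[cite: Greenberg2010, §2 p. 6 L5–8] -/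
theorem evalDual_smul (r : Λ) (x : E.dualSystem.limit) (d : D) :
    letI := E.limitModule Λ hΛ
    E.evalDual (r • x) d = E.evalDual x (r • d) :=
  E.evalDual_smulEnd Λ hΛ r x d

/-- The scalar action on `T*` commutes with `Γ_K` when the scalars act `Γ_K`-equivariantly on `D`.
[cite: Greenberg2010, §2 p. 6 L5–8] -/
theorem limitRep_smul (hΛτ : ∀ (σ : Field.absoluteGaloisGroup K) (r : Λ) (d : D), τ σ (r • d) = r • τ σ d)
    (σ : Field.absoluteGaloisGroup K) (r : Λ) (x : E.dualSystem.limit) :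
    letI := E.limitModule Λ hΛ
    E.dualSystem.limitRep σ (r • x) = r • E.dualSystem.limitRep σ x :=
  (E.dualEnd_limitRep _ _ (fun σ d => (hΛτ σ r d).symm) σ x).symm

/-- The scalar action on `T*` is continuous. [cite: Greenberg2010, §2 p. 6 L5–8] -/
theorem continuous_limitModule_smul (r : Λ) :
    letI := E.limitModule Λ hΛ
    Continuous fun x : E.dualSystem.limit => r • x :=
  E.continuous_dualEnd _ _

end Scalars

/-! ### `H¹_cont(Γ_K, T*) ≃ lim_k H¹(Γ_K, Hom(D_k, μ_{p^k}))` and its restriction to a subgroup -/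

section H1

variable [NeZero p]

/-- **`H¹_cont(Γ_K, T*) ≃ lim_k H¹(Γ_K, Hom(D_k, μ_{p^k}))`** (NSW (2.7.5) in degree `1`, the tree's
`DiscreteInvSystem.continuousCohomologyOneLimitEquiv`, whose hypotheses — surjective transitions, finite
levels, a cofinal chain — are discharged here). [cite: NeukirchSchmidtWingberg2008, II §7 Thm 2.7.5]
[cite: Greenberg2010, §2 p. 6 L1–12] -/
def continuousCohomologyOneEquiv :
    continuousCohomology 1 E.dualSystem.limitRep.toTopRep ≃+
      E.dualSystem.cohomologyLimit 1 :=
  E.dualSystem.continuousCohomologyOneLimitEquiv E.chain (fun h => E.dualRes_surjective h)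
    E.finite_layerDual

/-- Coordinates of the comparison: the `k`-th component is `H¹` of the projection `T* → Hom(D_k, μ_{p^k})`.
[cite: NeukirchSchmidtWingberg2008, II §7 Thm 2.7.5] -/
theorem coe_continuousCohomologyOneEquiv_apply
    (y : continuousCohomology 1 E.dualSystem.limitRep.toTopRep) (k : ℕ) :
    (E.continuousCohomologyOneEquiv y :
        ∀ k, continuousCohomology 1 (E.dualSystem.ρ k).toTopRep) k =
      cohomologyMap (E.dualSystem.projHom k) 1 y := rfl

variable {H : Type} [Group H] [TopologicalSpace H] [IsTopologicalGroup H]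
  (φ : H →ₜ* Field.absoluteGaloisGroup K)

/-- **`H¹_cont(H, T*) ≃ lim_k H¹(H, Hom(D_k, μ_{p^k}))` for a topological group `H → Γ_K`** (e.g. the
decomposition group `Γ_{K_v} → Γ_K`), the local twin of `continuousCohomologyOneEquiv`.
[cite: NeukirchSchmidtWingberg2008, II §7 Thm 2.7.5] [cite: Greenberg2010, Prop. 2.1.1 proof (p. 8 L1–6)] -/
def continuousCohomologyOneEquivComap :
    continuousCohomology 1 (E.dualSystem.comap φ).limitRep.toTopRep ≃+
      (E.dualSystem.comap φ).cohomologyLimit 1 :=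
  (E.dualSystem.comap φ).continuousCohomologyOneLimitEquiv (E.dualSystem.comapChain φ E.chain)
    (fun h => E.dualRes_surjective h) E.finite_layerDual

end H1

end DiscreteGaloisModule.TorsionLayers

end Literature.NumberTheory.GaloisRepresentations

end
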